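import Mathlib
import Summits.FinalStateConjecture.FinalStateConjecture.Theorems.EIHFluxBalanceModulatedKerrHandoffDragDefectTaylor

/-!
# Route EIHFluxBalance — `ModulatedKerrHandoff`, stub `stub_dragDefect`: the affine-drag Taylor
# remainders, second derivatives

Helper file for the crux `stmt-FinalStateConjecture-10167`
(`Summit.FinalStateConjecture.FinalStateConjecture.Theses.EIHFluxBalance.ModulatedKerrHandoff`),
line `overlap-modulation-second-iterate`, stub `stub_dragDefect`. Continuation of
`…DragDefectTaylor`: for `ψ` smooth on an open convex `U ∋ x, x + Ax` with `‖Dᵏψ‖ ≤ Cₖ` on `U`,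
the SECOND derivatives at `x` of the remainders `S(y) = ψ(y + Ay) − ψ(y) − Dψ(y)[Ay]`,
`Δ(y) = ψ(y + Ay) − ψ(y)` and of `ψ(· + A·)` in closed form (`hasFDerivAt_fderiv_rem`,
`hasFDerivAt_fderiv_delta`, `hasFDerivAt_fderiv_comp_affine`), and the bounds

* `‖D²S(x)(v,u)‖ ≤ (C₄‖Ax‖² + 2C₃‖A‖‖Ax‖ + C₂‖A‖²)‖v‖‖u‖` (`norm_fderiv_fderiv_rem_apply_le`; the
  cancellations use the symmetry of `D²ψ(x)` and the full symmetry of `D³ψ(x)`),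
* `‖D²Δ(x)(v,u)‖ ≤ (C₃‖Ax‖ + C₂(2‖A‖ + ‖A‖²))‖v‖‖u‖` (`norm_fderiv_fderiv_delta_apply_le`),
* `‖D²(ψ(· + A·))(x)(v,u)‖ ≤ C₂(1 + ‖A‖)²‖v‖‖u‖` (`norm_fderiv_fderiv_comp_affine_apply_le`).

Elementary (Dieudonné 1960, (8.12.2), (8.14.3)); no definitions.
-/

noncomputable section

-- `Summit.<S>.<S>.…` (single-problem summit, D-0017) trips core's duplicate-namespace linter.
set_option linter.dupNamespace false
-- nested operator spaces `E →L E →L E →L G`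
set_option maxSynthPendingDepth 3

open Set Filter ContinuousLinearMap
open scoped Topology ContDiff

namespace Summit.FinalStateConjecture.FinalStateConjecture.Theorems

namespace DragDefect

variable {E G : Type*} [NormedAddCommGroup E] [NormedSpace ℝ E] [NormedAddCommGroup G]
  [NormedSpace ℝ G]

/-! ### Second derivatives of the remainders -/

section Second

variable {ψ : E → G} {U : Set E} {A : E →L[ℝ] E} {x z : E} {C₀ C₁ C₂ C₃ C₄ : ℝ}

/-- `D[y ↦ Dψ(y + Ay) ∘ L](z) = (· ∘ L) ∘ (D²ψ(z + Az) ∘ (1 + A))` for a fixed `L`. [folklore] -/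
theorem hasFDerivAt_fderiv_comp_affine_comp (hUo : IsOpen U) (hψ : ContDiffOn ℝ ∞ ψ U)
    (hAz : z + A z ∈ U) (L : E →L[ℝ] E) :
    HasFDerivAt (fun y ↦ (fderiv ℝ ψ (y + A y)).comp L)
      ((ContinuousLinearMap.precomp G L).comp
        ((fderiv ℝ (fderiv ℝ ψ) (z + A z)).comp (ContinuousLinearMap.id ℝ E + A))) z := by
  have h1 : HasFDerivAt (fun y ↦ fderiv ℝ ψ (y + A y))
      ((fderiv ℝ (fderiv ℝ ψ) (z + A z)).comp (ContinuousLinearMap.id ℝ E + A)) z :=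
    (hasFDerivAt_fderiv_of_mem hUo hψ hAz).comp z (hasFDerivAt_affine A z)
  exact (ContinuousLinearMap.precomp G L).hasFDerivAt.comp z h1

/-- `D[y ↦ Dψ(y) ∘ A](z) = (· ∘ A) ∘ D²ψ(z)`. [folklore] -/
theorem hasFDerivAt_fderiv_comp (hUo : IsOpen U) (hψ : ContDiffOn ℝ ∞ ψ U) (hz : z ∈ U) :
    HasFDerivAt (fun y ↦ (fderiv ℝ ψ y).comp A)
      ((ContinuousLinearMap.precomp G A).comp (fderiv ℝ (fderiv ℝ ψ) z)) z := by
  have h := (ContinuousLinearMap.precomp G A).hasFDerivAt.comp z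
    (hasFDerivAt_fderiv_of_mem hUo hψ hz)
  exact h

/-- `D[y ↦ (D²ψ(y))ᵗ(Ay)](z) = (D²ψ(z))ᵗ ∘ A + (flip ∘ D³ψ(z))ᵗ(Az)`. [folklore] -/
theorem hasFDerivAt_fderiv_fderiv_flip_apply (hUo : IsOpen U) (hψ : ContDiffOn ℝ ∞ ψ U)
    (hz : z ∈ U) :
    HasFDerivAt (fun y ↦ (fderiv ℝ (fderiv ℝ ψ) y).flip (A y))
      ((fderiv ℝ (fderiv ℝ ψ) z).flip.comp A
        + ((((ContinuousLinearMap.flipₗᵢ ℝ E E G).toContinuousLinearEquiv :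
            (E →L[ℝ] E →L[ℝ] G) →L[ℝ] (E →L[ℝ] E →L[ℝ] G))).comp
            (fderiv ℝ (fderiv ℝ (fderiv ℝ ψ)) z)).flip (A z)) z := by
  set flipL : (E →L[ℝ] E →L[ℝ] G) →L[ℝ] (E →L[ℝ] E →L[ℝ] G) :=
    ((ContinuousLinearMap.flipₗᵢ ℝ E E G).toContinuousLinearEquiv :
      (E →L[ℝ] E →L[ℝ] G) →L[ℝ] (E →L[ℝ] E →L[ℝ] G)) with hflipL
  have hD3 : HasFDerivAt (fderiv ℝ (fderiv ℝ ψ)) (fderiv ℝ (fderiv ℝ (fderiv ℝ ψ)) z) z :=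
    hasFDerivAt_fderiv_of_mem hUo (contDiffOn_fderiv_of_isOpen hUo hψ) hz
  have hc : HasFDerivAt (fun y ↦ (fderiv ℝ (fderiv ℝ ψ) y).flip)
      (flipL.comp (fderiv ℝ (fderiv ℝ (fderiv ℝ ψ)) z)) z := by
    have h := flipL.hasFDerivAt.comp z hD3
    exact h
  have h := hc.clm_apply A.hasFDerivAt
  exact h

/-- **Second derivative of the second-order remainder**, in closed form at `x`
(`x, x + Ax ∈ U`). [folklore] -/
theorem hasFDerivAt_fderiv_rem (hUo : IsOpen U) (hψ : ContDiffOn ℝ ∞ ψ U) (hx : x ∈ U)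
    (hAx : x + A x ∈ U) :
    HasFDerivAt (fderiv ℝ (fun y ↦ ψ (y + A y) - ψ y - fderiv ℝ ψ y (A y)))
      ((ContinuousLinearMap.precomp G (ContinuousLinearMap.id ℝ E + A)).comp
          ((fderiv ℝ (fderiv ℝ ψ) (x + A x)).comp (ContinuousLinearMap.id ℝ E + A))
        - fderiv ℝ (fderiv ℝ ψ) x
        - ((ContinuousLinearMap.precomp G A).comp (fderiv ℝ (fderiv ℝ ψ) x)
          + ((fderiv ℝ (fderiv ℝ ψ) x).flip.comp A
            + ((((ContinuousLinearMap.flipₗᵢ ℝ E E G).toContinuousLinearEquiv :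
                (E →L[ℝ] E →L[ℝ] G) →L[ℝ] (E →L[ℝ] E →L[ℝ] G))).comp
                (fderiv ℝ (fderiv ℝ (fderiv ℝ ψ)) x)).flip (A x)))) x := by
  -- the derivative of `S` near `x` in closed form
  have hopen : IsOpen {y : E | y ∈ U ∧ y + A y ∈ U} :=
    hUo.inter (hUo.preimage (continuous_id.add A.continuous))
  have hev : fderiv ℝ (fun y ↦ ψ (y + A y) - ψ y - fderiv ℝ ψ y (A y)) =ᶠ[𝓝 x]
      fun y ↦ (fderiv ℝ ψ (y + A y)).comp (ContinuousLinearMap.id ℝ E + A) - fderiv ℝ ψ y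
        - ((fderiv ℝ ψ y).comp A + (fderiv ℝ (fderiv ℝ ψ) y).flip (A y)) := by
    filter_upwards [hopen.mem_nhds ⟨hx, hAx⟩] with y hy
    exact (hasFDerivAt_rem hUo hψ hy.1 hy.2).fderiv
  rw [hev.hasFDerivAt_iff]
  exact ((hasFDerivAt_fderiv_comp_affine_comp hUo hψ hAx _).sub
    (hasFDerivAt_fderiv_of_mem hUo hψ hx)).sub
    ((hasFDerivAt_fderiv_comp hUo hψ hx).add (hasFDerivAt_fderiv_fderiv_flip_apply hUo hψ hx))

/-- **Second derivative of the first-order remainder**, in closed form at `x`. [folklore] -/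
theorem hasFDerivAt_fderiv_delta (hUo : IsOpen U) (hψ : ContDiffOn ℝ ∞ ψ U) (hx : x ∈ U)
    (hAx : x + A x ∈ U) :
    HasFDerivAt (fderiv ℝ (fun y ↦ ψ (y + A y) - ψ y))
      ((ContinuousLinearMap.precomp G (ContinuousLinearMap.id ℝ E + A)).comp
          ((fderiv ℝ (fderiv ℝ ψ) (x + A x)).comp (ContinuousLinearMap.id ℝ E + A))
        - fderiv ℝ (fderiv ℝ ψ) x) x := by
  have hopen : IsOpen {y : E | y ∈ U ∧ y + A y ∈ U} :=
    hUo.inter (hUo.preimage (continuous_id.add A.continuous))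
  have hev : fderiv ℝ (fun y ↦ ψ (y + A y) - ψ y) =ᶠ[𝓝 x]
      fun y ↦ (fderiv ℝ ψ (y + A y)).comp (ContinuousLinearMap.id ℝ E + A) - fderiv ℝ ψ y := by
    filter_upwards [hopen.mem_nhds ⟨hx, hAx⟩] with y hy
    exact (hasFDerivAt_delta hUo hψ hy.1 hy.2).fderiv
  rw [hev.hasFDerivAt_iff]
  exact (hasFDerivAt_fderiv_comp_affine_comp hUo hψ hAx _).sub
    (hasFDerivAt_fderiv_of_mem hUo hψ hx)

/-- **Second derivative of the composite** `ψ(· + A·)`, in closed form at `x`. [folklore] -/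
theorem hasFDerivAt_fderiv_comp_affine (hUo : IsOpen U) (hψ : ContDiffOn ℝ ∞ ψ U)
    (hAx : x + A x ∈ U) :
    HasFDerivAt (fderiv ℝ (fun y ↦ ψ (y + A y)))
      ((ContinuousLinearMap.precomp G (ContinuousLinearMap.id ℝ E + A)).comp
          ((fderiv ℝ (fderiv ℝ ψ) (x + A x)).comp (ContinuousLinearMap.id ℝ E + A))) x := by
  have hopen : IsOpen {y : E | y + A y ∈ U} := hUo.preimage (continuous_id.add A.continuous)
  have hev : fderiv ℝ (fun y ↦ ψ (y + A y)) =ᶠ[𝓝 x]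
      fun y ↦ (fderiv ℝ ψ (y + A y)).comp (ContinuousLinearMap.id ℝ E + A) := by
    filter_upwards [hopen.mem_nhds hAx] with y hy
    exact (hasFDerivAt_comp_affine hUo hψ hy).fderiv
  rw [hev.hasFDerivAt_iff]
  exact hasFDerivAt_fderiv_comp_affine_comp hUo hψ hAx _

/-- Pointwise values of the closed forms: `[(· ∘ L) ∘ (M ∘ L')] v u = M (L' v) (L u)`. [folklore] -/
theorem precomp_comp_comp_apply (L L' : E →L[ℝ] E) (M : E →L[ℝ] E →L[ℝ] G) (v u : E) :
    ((ContinuousLinearMap.precomp G L).comp (M.comp L')) v u = M (L' v) (L u) := rfl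

/-- Pointwise value of the `flip` term: `[(flip ∘ T)ᵗ w] v u = T v u w`. [folklore] -/
theorem flip_comp_flip_apply (T : E →L[ℝ] E →L[ℝ] E →L[ℝ] G) (w v u : E) :
    ((((ContinuousLinearMap.flipₗᵢ ℝ E E G).toContinuousLinearEquiv :
        (E →L[ℝ] E →L[ℝ] G) →L[ℝ] (E →L[ℝ] E →L[ℝ] G))).comp T).flip w v u = T v u w := rfl

/-- **`‖D²S(x)(v, u)‖ ≤ (C₄ ‖Ax‖² + 2 C₃ ‖A‖ ‖Ax‖ + C₂ ‖A‖²) ‖v‖ ‖u‖`**: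
`D²S(x)(v,u) = [D²ψ(x+Ax) − D²ψ(x) − D³ψ(x)(Ax)](v,u) + [D²ψ(x+Ax) − D²ψ(x)](v, Au)
+ [D²ψ(x+Ax) − D²ψ(x)](Av, u) + D²ψ(x+Ax)(Av, Au)` after the symmetries
`D²ψ(x)(Av,u) = D²ψ(x)(u,Av)`, `D³ψ(x)(v,u,Ax) = D³ψ(x)(Ax,v,u)`. [folklore] -/
theorem norm_fderiv_fderiv_rem_apply_le (hUo : IsOpen U) (hUc : Convex ℝ U)
    (hψ : ContDiffOn ℝ ∞ ψ U) (hx : x ∈ U) (hAx : x + A x ∈ U)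
    (h2 : ∀ z ∈ U, ‖fderiv ℝ (fderiv ℝ ψ) z‖ ≤ C₂)
    (h3 : ∀ z ∈ U, ‖fderiv ℝ (fderiv ℝ (fderiv ℝ ψ)) z‖ ≤ C₃)
    (h4 : ∀ z ∈ U, ‖fderiv ℝ (fderiv ℝ (fderiv ℝ (fderiv ℝ ψ))) z‖ ≤ C₄) (v u : E) :
    ‖fderiv ℝ (fderiv ℝ (fun y ↦ ψ (y + A y) - ψ y - fderiv ℝ ψ y (A y))) x v u‖ ≤
      (C₄ * ‖A x‖ ^ 2 + 2 * C₃ * ‖A‖ * ‖A x‖ + C₂ * ‖A‖ ^ 2) * ‖v‖ * ‖u‖ := by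
  rw [(hasFDerivAt_fderiv_rem hUo hψ hx hAx).fderiv]
  set M := fderiv ℝ (fderiv ℝ ψ) (x + A x) with hM
  set M₀ := fderiv ℝ (fderiv ℝ ψ) x with hM₀
  set T := fderiv ℝ (fderiv ℝ (fderiv ℝ ψ)) x with hT
  have hC₂ : 0 ≤ C₂ := (norm_nonneg _).trans (h2 x hx)
  have hC₃ : 0 ≤ C₃ := (norm_nonneg _).trans (h3 x hx)
  -- pointwise value
  have hval : ((ContinuousLinearMap.precomp G (ContinuousLinearMap.id ℝ E + A)).comp
          (M.comp (ContinuousLinearMap.id ℝ E + A))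
        - M₀ - ((ContinuousLinearMap.precomp G A).comp M₀
          + (M₀.flip.comp A
            + ((((ContinuousLinearMap.flipₗᵢ ℝ E E G).toContinuousLinearEquiv :
                (E →L[ℝ] E →L[ℝ] G) →L[ℝ] (E →L[ℝ] E →L[ℝ] G))).comp T).flip (A x)))) v u =
      (M - M₀ - T (A x)) v u + (M - M₀) v (A u) + (M - M₀) (A v) u + M (A v) (A u)
        + (M₀ (A v) u - M₀ u (A v)) + (T (A x) v u - T v u (A x)) := by
    simp only [_root_.sub_apply, _root_.add_apply,
      ContinuousLinearMap.comp_apply, ContinuousLinearMap.precomp_apply,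
      ContinuousLinearMap.flip_apply, ContinuousLinearMap.id_apply, map_add]
    abel
  have hsym₂ : M₀ (A v) u - M₀ u (A v) = 0 := by
    rw [hM₀, fderiv_fderiv_symm hUo hψ hx (A v) u, sub_self]
  have hsym₃ : T (A x) v u - T v u (A x) = 0 := by
    rw [hT, fderiv₃_cycle hUo hψ hx v u (A x), sub_self]
  rw [hval, hsym₂, hsym₃, add_zero, add_zero]
  -- the four terms
  have hdiff : ‖M - M₀‖ ≤ C₃ * ‖A x‖ := norm_fderiv_fderiv_sub_le hUo hUc hψ hx hAx h3
  have t1 : ‖(M - M₀ - T (A x)) v u‖ ≤ C₄ * ‖A x‖ ^ 2 * ‖v‖ * ‖u‖ := by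
    have hD2 : ∀ z ∈ U, DifferentiableAt ℝ (fderiv ℝ (fderiv ℝ ψ)) z := fun z hz ↦
      (hasFDerivAt_fderiv_of_mem hUo (contDiffOn_fderiv_of_isOpen hUo hψ) hz).differentiableAt
    have hD3 : ∀ z ∈ U, DifferentiableAt ℝ (fderiv ℝ (fderiv ℝ (fderiv ℝ ψ))) z := fun z hz ↦
      (hasFDerivAt_fderiv_of_mem hUo (contDiffOn_fderiv_of_isOpen hUo
        (contDiffOn_fderiv_of_isOpen hUo hψ)) hz).differentiableAt
    have htay : ‖M - M₀ - T (A x)‖ ≤ C₄ * ‖A x‖ ^ 2 := norm_taylor₂_le hUc hD2 hD3 h4 hx hAx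
    calc _ ≤ ‖M - M₀ - T (A x)‖ * ‖v‖ * ‖u‖ := le_opNorm₂ _ _ _
      _ ≤ _ := by gcongr
  have t2 : ‖(M - M₀) v (A u)‖ ≤ C₃ * ‖A x‖ * ‖v‖ * (‖A‖ * ‖u‖) :=
    (le_opNorm₂ _ _ _).trans (by gcongr; exact le_opNorm _ _)
  have t3 : ‖(M - M₀) (A v) u‖ ≤ C₃ * ‖A x‖ * (‖A‖ * ‖v‖) * ‖u‖ :=
    (le_opNorm₂ _ _ _).trans (by gcongr; exact le_opNorm _ _)
  have t4 : ‖M (A v) (A u)‖ ≤ C₂ * (‖A‖ * ‖v‖) * (‖A‖ * ‖u‖) :=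
    (le_opNorm₂ _ _ _).trans (by
      gcongr
      · exact h2 _ hAx
      · exact le_opNorm _ _
      · exact le_opNorm _ _)
  calc _ ≤ C₄ * ‖A x‖ ^ 2 * ‖v‖ * ‖u‖ + C₃ * ‖A x‖ * ‖v‖ * (‖A‖ * ‖u‖)
        + C₃ * ‖A x‖ * (‖A‖ * ‖v‖) * ‖u‖ + C₂ * (‖A‖ * ‖v‖) * (‖A‖ * ‖u‖) :=
          norm_add_le_of_le (norm_add_le_of_le (norm_add_le_of_le t1 t2) t3) t4
    _ = _ := by ring

/-- **`‖D²Δ(x)(v, u)‖ ≤ (C₃ ‖Ax‖ + C₂ (2‖A‖ + ‖A‖²)) ‖v‖ ‖u‖`**. [folklore] -/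
theorem norm_fderiv_fderiv_delta_apply_le (hUo : IsOpen U) (hUc : Convex ℝ U)
    (hψ : ContDiffOn ℝ ∞ ψ U) (hx : x ∈ U) (hAx : x + A x ∈ U)
    (h2 : ∀ z ∈ U, ‖fderiv ℝ (fderiv ℝ ψ) z‖ ≤ C₂)
    (h3 : ∀ z ∈ U, ‖fderiv ℝ (fderiv ℝ (fderiv ℝ ψ)) z‖ ≤ C₃) (v u : E) :
    ‖fderiv ℝ (fderiv ℝ (fun y ↦ ψ (y + A y) - ψ y)) x v u‖ ≤
      (C₃ * ‖A x‖ + C₂ * (2 * ‖A‖ + ‖A‖ ^ 2)) * ‖v‖ * ‖u‖ := by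
  rw [(hasFDerivAt_fderiv_delta hUo hψ hx hAx).fderiv]
  set M := fderiv ℝ (fderiv ℝ ψ) (x + A x) with hM
  set M₀ := fderiv ℝ (fderiv ℝ ψ) x with hM₀
  have hC₂ : 0 ≤ C₂ := (norm_nonneg _).trans (h2 x hx)
  have hval : ((ContinuousLinearMap.precomp G (ContinuousLinearMap.id ℝ E + A)).comp
          (M.comp (ContinuousLinearMap.id ℝ E + A)) - M₀) v u =
      (M - M₀) v u + M v (A u) + M (A v) u + M (A v) (A u) := by
    simp only [_root_.sub_apply, _root_.add_apply,
      ContinuousLinearMap.comp_apply, ContinuousLinearMap.precomp_apply,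
      ContinuousLinearMap.id_apply, map_add]
    abel
  rw [hval]
  have hMn : ‖M‖ ≤ C₂ := h2 _ hAx
  have t1 : ‖(M - M₀) v u‖ ≤ C₃ * ‖A x‖ * ‖v‖ * ‖u‖ :=
    (le_opNorm₂ _ _ _).trans (by gcongr; exact norm_fderiv_fderiv_sub_le hUo hUc hψ hx hAx h3)
  have t2 : ‖M v (A u)‖ ≤ C₂ * ‖v‖ * (‖A‖ * ‖u‖) :=
    (le_opNorm₂ _ _ _).trans (by gcongr; exact le_opNorm _ _)
  have t3 : ‖M (A v) u‖ ≤ C₂ * (‖A‖ * ‖v‖) * ‖u‖ :=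
    (le_opNorm₂ _ _ _).trans (by gcongr; exact le_opNorm _ _)
  have t4 : ‖M (A v) (A u)‖ ≤ C₂ * (‖A‖ * ‖v‖) * (‖A‖ * ‖u‖) :=
    (le_opNorm₂ _ _ _).trans (by
      gcongr
      · exact le_opNorm _ _
      · exact le_opNorm _ _)
  calc _ ≤ C₃ * ‖A x‖ * ‖v‖ * ‖u‖ + C₂ * ‖v‖ * (‖A‖ * ‖u‖) + C₂ * (‖A‖ * ‖v‖) * ‖u‖
        + C₂ * (‖A‖ * ‖v‖) * (‖A‖ * ‖u‖) :=
          norm_add_le_of_le (norm_add_le_of_le (norm_add_le_of_le t1 t2) t3) t4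
    _ = _ := by ring

/-- **`‖D²(ψ(· + A·))(x)(v, u)‖ ≤ C₂ (1 + ‖A‖)² ‖v‖ ‖u‖`**. [folklore] -/
theorem norm_fderiv_fderiv_comp_affine_apply_le (hUo : IsOpen U) (hψ : ContDiffOn ℝ ∞ ψ U)
    (hAx : x + A x ∈ U) (h2 : ∀ z ∈ U, ‖fderiv ℝ (fderiv ℝ ψ) z‖ ≤ C₂) (v u : E) :
    ‖fderiv ℝ (fderiv ℝ (fun y ↦ ψ (y + A y))) x v u‖ ≤ C₂ * (1 + ‖A‖) ^ 2 * ‖v‖ * ‖u‖ := by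
  rw [(hasFDerivAt_fderiv_comp_affine hUo hψ hAx).fderiv, precomp_comp_comp_apply]
  have hC₂ : 0 ≤ C₂ := (norm_nonneg _).trans (h2 _ hAx)
  have hL : ∀ w : E, ‖(ContinuousLinearMap.id ℝ E + A) w‖ ≤ (1 + ‖A‖) * ‖w‖ := by
    intro w
    rw [_root_.add_apply, ContinuousLinearMap.id_apply, add_mul, one_mul]
    exact norm_add_le_of_le le_rfl (le_opNorm _ _)
  calc _ ≤ ‖fderiv ℝ (fderiv ℝ ψ) (x + A x)‖ * ‖(ContinuousLinearMap.id ℝ E + A) v‖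
        * ‖(ContinuousLinearMap.id ℝ E + A) u‖ := le_opNorm₂ _ _ _
    _ ≤ C₂ * ((1 + ‖A‖) * ‖v‖) * ((1 + ‖A‖) * ‖u‖) := by
        gcongr
        · exact h2 _ hAx
        · exact hL v
        · exact hL u
    _ = _ := by ring

end Second

/-- **Registered sub-goal form** (stub `dragDefect_taylor_fderiv_fderiv_rem` of the crux item) of
`norm_fderiv_fderiv_rem_apply_le`. [folklore] -/
theorem dragDefect_taylor_fderiv_fderiv_rem : ∀ {E G : Type*} [NormedAddCommGroup E] [NormedSpace ℝ E] [NormedAddCommGroup G] [NormedSpace ℝ G] {ψ : E → G} {U : Set E} {A : E →L[ℝ] E} {x : E} {C₂ C₃ C₄ : ℝ}, IsOpen U → Convex ℝ U → ContDiffOn ℝ ((⊤ : ℕ∞) : WithTop ℕ∞) ψ U → x ∈ U → x + A x ∈ U → (∀ z ∈ U, ‖fderiv ℝ (fderiv ℝ ψ) z‖ ≤ C₂) → (∀ z ∈ U, ‖fderiv ℝ (fderiv ℝ (fderiv ℝ ψ)) z‖ ≤ C₃) → (∀ z ∈ U, ‖fderiv ℝ (fderiv ℝ (fderiv ℝ (fderiv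 ℝ ψ))) z‖ ≤ C₄) → ∀ v u : E, ‖fderiv ℝ (fderiv ℝ (fun y ↦ ψ (y + A y) - ψ y - fderiv ℝ ψ y (A y))) x v u‖ ≤ (C₄ * ‖A x‖ ^ 2 + 2 * C₃ * ‖A‖ * ‖A x‖ + C₂ * ‖A‖ ^ 2) * ‖v‖ * ‖u‖ :=
  fun hUo hUc hψ hx hAx h2 h3 h4 v u ↦ norm_fderiv_fderiv_rem_apply_le hUo hUc hψ hx hAx h2 h3 h4 v u

end DragDefect

end Summit.FinalStateConjecture.FinalStateConjecture.Theorems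

end
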